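import Summits.ABC.IUTFork.Repair.RHHullCellSlice
import HarnessLib

/-!
# D-0123(C) REPAIR-CATALOGUE, KERNEL-CLOSE column, row RC-022 «label-global» (R-H round-1 row 22) × R-H round-3 AXIS D2 (height scaling):
# the PER-LABEL, PLACE-SUMMED licence of the integer cell currency is a LOW-HEIGHT statement — explicit two-sided bracket for every label `j ≥ 2`
# (PROOF-ONLY, 0 definitions, 0 `Prop` facts)

abc-iut cell, rung LADDER-ABC:A2 (D-0123 RCAT tester seat abc-iut-rcat-tst-2, KERNEL-CLOSE column; even R-H rows). Companion, at ONE LABEL, of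
abc-iut-rh2-w-2's datum-level barrier `Repair/RHHeightScalingBarrierDatum.lean` (p532641: the envelope SUMMED over all labels `j = 1 … L`), written over
the same ACCEPTED currency — abc-iut-rh2-w-2's `Repair/RHHullCellSlice.lean` (`hullCellδ_iff_demand_le_price`, `gain_bounds`) on abc-iut-rp-d3's exact
cell `RH.DiffPricedHull.HullCellδ` — and citing nothing else. Nothing is restated: the one-place price/gain facts are USED by name.

WHY (catalogue row RC-022, `plan/rescue/REPAIR-CATALOGUE.tsv`; R-H candidate `Repair.RH.LabelGlobal.HStarLabelGlobal`, p460565): the «label-global»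
reading licenses, for each label `j` SEPARATELY, the PLACE-SUMMED q-volume against the place-summed hull volume. In the integer cell currency of record
(R-W WINDOW-TABLE exact U2 cell; abc-iut-rcat-tst-4's engine reading of row 22, STATUS 2026-08-27T07:09Z: «label `j` globally licensed ⟺ Σ_v margin_{j,v}·u_v ≥ 0»)
this is, per label `j` and dilation `s` (depth `m_w ↦ s·m_w` at every bad place, places / `l` / `e_w` / `δ_w` / radii FIXED — the R78 ray):
  `Σ_w c_w·(j²−1)·(s·m_w) ≤ Σ_w c_w·price_j(w, s)`, `price_j(w, s) = j·δ_w + (j+1)·(r_in(w) − r_out(w)) + ρ_j(w, s)`, `ρ_j ∈ [0, e_w − 1]`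
(`RH.HullCellSlice.hullCellδ_iff_demand_le_price` / `gain_bounds`; weights `c_w ≥ 0`). The kernel-close word of RC-022 (CLOSES the Statement at level S
∧ KILLED stronger-than-Statement at the two-place bed) lacked a KERNEL face for its AXIS-D2 clause; this file supplies it in the cell currency.

WHAT IS PROVED (namespace `Summit.ABC.IUTFork.Repair.RcatLabelGlobalHeightScaling`; integers per place, reals across places; `0 < e_w`, `c_w ≥ 0`):
* §1 one place, one label: the price is HEIGHT-FREE between two caps `e − 1` apart — `price_le_capPlus` (`≤ jδ + (j+1)G + (e−1)`), `capMinus_le_price`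
  (`jδ + (j+1)G ≤`), at EVERY depth (so at every dilation).
* §2 the datum at a fixed label `j`: `labelEnvelope_le_capPlus`, `labelCapMinus_le_envelope` (weighted sums), `labelDemand_dilate`
  (`Σ_w c_w(j²−1)(s·m_w) = s·(j²−1)·Σ_w c_w m_w`); **`labelEnvelope_add_tol_lt_demand_of_lt`** — if `Σ_w c_w(jδ_w + (j+1)G_w + (e_w−1)) + tol <
  s·(j²−1)·Σ_w c_w m_w` (i.e. `s > s_j⁺ := (CAP_j⁺ + tol)/((j²−1)·M)`, `M = Σ_w c_w m_w`) then the label-`j` place-summed licence (with tolerance `tol`)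
  FAILS; **`labelDemand_le_envelope_of_le`** — if `s·(j²−1)·M ≤ Σ_w c_w(jδ_w + (j+1)G_w)` (`s ≤ s_j⁻ := CAP_j⁻/((j²−1)·M)`) it HOLDS;
  **`label_crossing_bracket`** — both: the label-`j` crossing lies in the closed-form bracket `[s_j⁻, s_j⁺]`, whose ends differ by
  `(Σ_w c_w(e_w−1) + tol)/((j²−1)·M)`. Since `CAP_j⁺` is linear in `j` and the demand quadratic, `s_j⁺` DECREASES in `j`: the last label to die is `j = 2`.
* §3 the «label-global» shape (EVERY label `j = 1 … L` place-summed licensed, tolerance `tol ≥ 0`): **`not_labelGlobal_of_lt`** — if `L ≥ 2` and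
  `Σ_w c_w(2δ_w + 3G_w + (e_w−1)) + tol < 3·s·M` then it FAILS (label `2` already does): the reading is a TABULATED-HEIGHT statement, dead beyond
  `S⁺ := (Σ_w c_w(2δ_w + 3G_w + e_w − 1) + tol)/(3M)` — the `c`-weighted average of the per-place slice-extinction thresholds `(2δ_w+3G_w+e_w−1)/(3m_w)` of
  abc-iut-rh2-q2-hull's `RHHullCellSliceHeightScaling.slice_eq_one_eventually` (p532065); and **`labelGlobal_of_cellwise`** — cellwise licence at every
  bad place (Σ₄ ∋ every cell of label `j`) implies the label-`j` place-summed licence (sum of licensed cells), i.e. the label-global reading is WEAKER than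
  the cellwise one at every dilation (consistent with RC-022's «level-S door, not an S_H rescue»).
* §4 the worked place FREY `p = 7`, `l = 107` (`e = 1605`, `m = 210`, `δ = 1604`, `r_in = 268`, `r_out = −4472`; abc-iut-topt-pv-2 p490925, p532641 §4) as a
  one-place datum: `frey7_l107_label2_bracket` — label `2`'s caps `CAP₂⁻ = 17 428`, `CAP₂⁺ = 19 032`, slope `3m = 630`, so `s₂⁻ = 27.66…`, `s₂⁺ = 30.20…`;
  `frey7_l107_label2_crossing` — by `decide` on the exact cell, label `2` of this place is licensed at `s = 29` and NOT at `s = 30` (inside the bracket),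
  whereas the all-label netted requirement of p532641 §4 fails from `s = 1` on: per-label and summed thresholds are different numbers, both closed-form.
DELIBERATELY NOT HERE: any typed dilation of a `Cor312.Setting` (none exists — the ray is the integer cell model of record, R78); the transcription of the
typed `HStarLabelGlobal` (place-summed VOLUMES over `Cor312.Setting`) into cell margins (an engine reading of record, abc-iut-rcat-tst-4, not a landed
declaration); datum tables of `s_j^±` (numerics seats); any abc endpoint.
HONEST FRAMING: integer/real arithmetic about OUR typed cell currency; «holds»/«fails» concern the label-wise place-summed licence of OUR exact cell
against OUR demand, not [IUTchIII] Cor. 3.12 in print; nothing here asserts that abc is proved or refuted, or that Cor. 3.12 / [IUTchIV] Thm. 1.10 holds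
or fails at any datum, or takes a side on any author (D-0045); the cell formula is a CONJECTURED column formula of OUR typed hull (refuted-as-typed ≠
refuted-in-print); typed ≠ proved; computed ≠ proved for any bed number quoted in prose. [folklore] throughout; [claim: Mochizuki2012, status: disputed]
for every IUT locution. [cite: Mochizuki2012, IUTchIII Cor. 3.12 p. 173–174, Step (xi-f) p. 184; IUTchIV Prop. 1.2 (i)(ii) p. 10, Thm. 1.10 p. 24–28]
-/

namespace Summit.ABC.IUTFork.Repair.RcatLabelGlobalHeightScaling

open Finset
open Summit.ABC.IUTFork.Repair.RH.DiffPricedHull Summit.ABC.IUTFork.Repair.RH.HullCellSlice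

/-! ## §1. One place, one label: the exact price is height-free between two caps `e − 1` apart -/

/-- **UPPER CAP, one cell**: `price_j(s) = jδ + (j+1)G + ρ_j ≤ jδ + (j+1)G + (e − 1)` at EVERY depth (`0 < e`; `ρ_j ≤ e − 1` is
`RH.HullCellSlice.gain_bounds`). [folklore] -/
theorem price_le_capPlus {e : ℤ} (he : 0 < e) (m j δ rin rout : ℤ) :
    j * δ + (j + 1) * (rin - rout) + (j ^ 2 * m - j * δ - (j + 1) * rin) % e ≤ j * δ + (j + 1) * (rin - rout) + (e - 1) := by
  have h := (gain_bounds he m j δ rin).2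
  linarith

/-- **LOWER CAP, one cell**: `jδ + (j+1)G ≤ price_j(s)` at EVERY depth (`0 < e`; `0 ≤ ρ_j`). [folklore] -/
theorem capMinus_le_price {e : ℤ} (he : 0 < e) (m j δ rin rout : ℤ) :
    j * δ + (j + 1) * (rin - rout) ≤ j * δ + (j + 1) * (rin - rout) + (j ^ 2 * m - j * δ - (j + 1) * rin) % e := by
  have h := (gain_bounds he m j δ rin).1
  linarith

/-- **The cell licence IS `demand ≤ price`** at the dilated depth `s·m` (`RH.HullCellSlice.hullCellδ_iff_demand_le_price`, restated at `s·m` for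
reference; no new content). [folklore] -/
theorem hullCellδ_dilate_iff (e m j δ rin rout s : ℤ) :
    HullCellδ e (s * m) j δ rin rout ↔
      (j ^ 2 - 1) * (s * m) ≤ j * δ + (j + 1) * (rin - rout) + (j ^ 2 * (s * m) - j * δ - (j + 1) * rin) % e :=
  hullCellδ_iff_demand_le_price e (s * m) j δ rin rout

/-! ## §2. The datum at a fixed label `j`: weighted place sums, explicit thresholds on both sides -/

variable {n : ℕ}

/-- **LABEL ENVELOPE ≤ CAP_j⁺** (height-free): `Σ_w c_w·price_j(w, s) ≤ Σ_w c_w·(jδ_w + (j+1)G_w + (e_w − 1))` at EVERY dilation `s`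
(`c_w ≥ 0`, `0 < e_w`). [folklore] -/
theorem labelEnvelope_le_capPlus (e m δ rin rout : Fin n → ℤ) (c : Fin n → ℝ) (j s : ℤ)
    (he : ∀ w, 0 < e w) (hc : ∀ w, 0 ≤ c w) :
    ∑ w, c w * ((j * δ w + (j + 1) * (rin w - rout w) + (j ^ 2 * (s * m w) - j * δ w - (j + 1) * rin w) % e w : ℤ) : ℝ) ≤
      ∑ w, c w * ((j * δ w + (j + 1) * (rin w - rout w) + (e w - 1) : ℤ) : ℝ) := by
  refine sum_le_sum fun w _ => mul_le_mul_of_nonneg_left ?_ (hc w)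
  exact_mod_cast price_le_capPlus (he w) (s * m w) j (δ w) (rin w) (rout w)

/-- **CAP_j⁻ ≤ LABEL ENVELOPE** (height-free): `Σ_w c_w·(jδ_w + (j+1)G_w) ≤ Σ_w c_w·price_j(w, s)` at EVERY dilation `s`. [folklore] -/
theorem labelCapMinus_le_envelope (e m δ rin rout : Fin n → ℤ) (c : Fin n → ℝ) (j s : ℤ)
    (he : ∀ w, 0 < e w) (hc : ∀ w, 0 ≤ c w) :
    ∑ w, c w * ((j * δ w + (j + 1) * (rin w - rout w) : ℤ) : ℝ) ≤
      ∑ w, c w * ((j * δ w + (j + 1) * (rin w - rout w) + (j ^ 2 * (s * m w) - j * δ w - (j + 1) * rin w) % e w : ℤ) : ℝ) := by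
  refine sum_le_sum fun w _ => mul_le_mul_of_nonneg_left ?_ (hc w)
  exact_mod_cast capMinus_le_price (he w) (s * m w) j (δ w) (rin w) (rout w)

/-- **The label-`j` demand total is the dilation times a height-free number**: `Σ_w c_w·(j²−1)·(s·m_w) = s·(j²−1)·Σ_w c_w·m_w`. [folklore] -/
theorem labelDemand_dilate (m : Fin n → ℤ) (c : Fin n → ℝ) (j s : ℤ) :
    ∑ w, c w * (((j ^ 2 - 1) * (s * m w) : ℤ) : ℝ) = (s : ℝ) * ((j : ℝ) ^ 2 - 1) * ∑ w, c w * ((m w : ℤ) : ℝ) := by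
  rw [mul_sum]
  refine sum_congr rfl fun w _ => ?_
  push_cast
  ring

/-- **LABEL `j` DIES BEYOND `s_j⁺`, explicit threshold.** If `Σ_w c_w·(jδ_w + (j+1)G_w + (e_w−1)) + tol < s·(j²−1)·Σ_w c_w·m_w` — the dilation `s`
is beyond `s_j⁺ := (CAP_j⁺ + tol)/((j²−1)·M)` — then the label-`j` place-summed price plus the tolerance falls STRICTLY SHORT of the label-`j` demand:
the label-global licence of label `j` FAILS at `s` (height-free credit, linear in `j`, against a demand `∝ s·(j²−1)`). [folklore] -/
theorem labelEnvelope_add_tol_lt_demand_of_lt (e m δ rin rout : Fin n → ℤ) (c : Fin n → ℝ) (j s : ℤ) (tol : ℝ)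
    (he : ∀ w, 0 < e w) (hc : ∀ w, 0 ≤ c w)
    (hs : ∑ w, c w * ((j * δ w + (j + 1) * (rin w - rout w) + (e w - 1) : ℤ) : ℝ) + tol <
        (s : ℝ) * ((j : ℝ) ^ 2 - 1) * ∑ w, c w * ((m w : ℤ) : ℝ)) :
    ∑ w, c w * ((j * δ w + (j + 1) * (rin w - rout w) + (j ^ 2 * (s * m w) - j * δ w - (j + 1) * rin w) % e w : ℤ) : ℝ) + tol <
      ∑ w, c w * (((j ^ 2 - 1) * (s * m w) : ℤ) : ℝ) := by
  have h1 := labelEnvelope_le_capPlus e m δ rin rout c j s he hc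
  have h2 := labelDemand_dilate m c j s
  linarith

/-- **LABEL `j` HOLDS BELOW `s_j⁻`, explicit threshold.** If `s·(j²−1)·Σ_w c_w·m_w ≤ Σ_w c_w·(jδ_w + (j+1)G_w)` — `s ≤ s_j⁻ := CAP_j⁻/((j²−1)·M)` —
then the label-`j` demand fits under the label-`j` price total: the label-global licence of label `j` HOLDS at `s` (content-free, whatever the
residues). [folklore] -/
theorem labelDemand_le_envelope_of_le (e m δ rin rout : Fin n → ℤ) (c : Fin n → ℝ) (j s : ℤ)
    (he : ∀ w, 0 < e w) (hc : ∀ w, 0 ≤ c w)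
    (hs : (s : ℝ) * ((j : ℝ) ^ 2 - 1) * ∑ w, c w * ((m w : ℤ) : ℝ) ≤
        ∑ w, c w * ((j * δ w + (j + 1) * (rin w - rout w) : ℤ) : ℝ)) :
    ∑ w, c w * (((j ^ 2 - 1) * (s * m w) : ℤ) : ℝ) ≤
      ∑ w, c w * ((j * δ w + (j + 1) * (rin w - rout w) + (j ^ 2 * (s * m w) - j * δ w - (j + 1) * rin w) % e w : ℤ) : ℝ) := by
  have h1 := labelCapMinus_le_envelope e m δ rin rout c j s he hc
  have h2 := labelDemand_dilate m c j s
  linarith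

/-- **THE LABEL-`j` CROSSING BRACKET** (both sides; `tol ≥ 0`): the netted label-`j` licence «`DEM_j(s) ≤ ENV_j(s) + tol`» HOLDS at every dilation
`s ≤ s_j⁻` and FAILS at every dilation `s > s_j⁺`, where `CAP_j⁺ − CAP_j⁻ = Σ_w c_w·(e_w − 1)` — a closed-form bracket on the label-`j` crossing,
datum by datum. [folklore] -/
theorem label_crossing_bracket (e m δ rin rout : Fin n → ℤ) (c : Fin n → ℝ) (j s : ℤ) (tol : ℝ)
    (he : ∀ w, 0 < e w) (hc : ∀ w, 0 ≤ c w) (htol : 0 ≤ tol) :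
    ((s : ℝ) * ((j : ℝ) ^ 2 - 1) * ∑ w, c w * ((m w : ℤ) : ℝ) ≤ ∑ w, c w * ((j * δ w + (j + 1) * (rin w - rout w) : ℤ) : ℝ) →
      ∑ w, c w * (((j ^ 2 - 1) * (s * m w) : ℤ) : ℝ) ≤
        ∑ w, c w * ((j * δ w + (j + 1) * (rin w - rout w) + (j ^ 2 * (s * m w) - j * δ w - (j + 1) * rin w) % e w : ℤ) : ℝ) + tol) ∧
    (∑ w, c w * ((j * δ w + (j + 1) * (rin w - rout w) + (e w - 1) : ℤ) : ℝ) + tol <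
        (s : ℝ) * ((j : ℝ) ^ 2 - 1) * ∑ w, c w * ((m w : ℤ) : ℝ) →
      ¬ (∑ w, c w * (((j ^ 2 - 1) * (s * m w) : ℤ) : ℝ) ≤
        ∑ w, c w * ((j * δ w + (j + 1) * (rin w - rout w) + (j ^ 2 * (s * m w) - j * δ w - (j + 1) * rin w) % e w : ℤ) : ℝ) + tol)) := by
  refine ⟨fun hs => ?_, fun hs h => ?_⟩
  · have := labelDemand_le_envelope_of_le e m δ rin rout c j s he hc hs
    linarith
  · have := labelEnvelope_add_tol_lt_demand_of_lt e m δ rin rout c j s tol he hc hs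
    linarith

/-! ## §3. The «label-global» shape: every label place-summed licensed — dead as soon as label `2` dies; weaker than cellwise -/

/-- **THE LABEL-GLOBAL READING IS A TABULATED-HEIGHT STATEMENT.** If `L ≥ 2` and
`Σ_w c_w·(2δ_w + 3G_w + (e_w − 1)) + tol < 3·s·Σ_w c_w·m_w` — the dilation is beyond `S⁺ := (CAP₂⁺ + tol)/(3M)`, the `c`-weighted average of the
per-place slice-extinction thresholds `(2δ_w + 3G_w + e_w − 1)/(3m_w)` of `RHHullCellSliceHeightScaling.slice_eq_one_eventually` — then it is NOT the case
that every label `j = 1 + k`, `k < L`, is place-summed licensed with tolerance `tol`: label `2` (`k = 1`) already fails. [folklore] -/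
theorem not_labelGlobal_of_lt (e m δ rin rout : Fin n → ℤ) (c : Fin n → ℝ) (L : ℕ) (s : ℤ) (tol : ℝ)
    (he : ∀ w, 0 < e w) (hc : ∀ w, 0 ≤ c w) (hL : 2 ≤ L)
    (hs : ∑ w, c w * ((2 * δ w + 3 * (rin w - rout w) + (e w - 1) : ℤ) : ℝ) + tol <
        3 * (s : ℝ) * ∑ w, c w * ((m w : ℤ) : ℝ)) :
    ¬ ∀ k ∈ range L,
        ∑ w, c w * ((((1 + (k : ℤ)) ^ 2 - 1) * (s * m w) : ℤ) : ℝ) ≤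
          ∑ w, c w * (((1 + (k : ℤ)) * δ w + (1 + (k : ℤ) + 1) * (rin w - rout w) +
            ((1 + (k : ℤ)) ^ 2 * (s * m w) - (1 + (k : ℤ)) * δ w - (1 + (k : ℤ) + 1) * rin w) % e w : ℤ) : ℝ) + tol := by
  intro h
  have h2 := h 1 (mem_range.mpr (by omega))
  have hs' : ∑ w, c w * (((2 : ℤ) * δ w + (2 + 1) * (rin w - rout w) + (e w - 1) : ℤ) : ℝ) + tol <
      (s : ℝ) * (((2 : ℤ) : ℝ) ^ 2 - 1) * ∑ w, c w * ((m w : ℤ) : ℝ) := by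
    have e1 : ∑ w, c w * (((2 : ℤ) * δ w + (2 + 1) * (rin w - rout w) + (e w - 1) : ℤ) : ℝ) =
        ∑ w, c w * ((2 * δ w + 3 * (rin w - rout w) + (e w - 1) : ℤ) : ℝ) :=
      sum_congr rfl fun w _ => by push_cast; ring
    rw [e1]
    have e2 : (s : ℝ) * (((2 : ℤ) : ℝ) ^ 2 - 1) * ∑ w, c w * ((m w : ℤ) : ℝ) = 3 * (s : ℝ) * ∑ w, c w * ((m w : ℤ) : ℝ) := by
      push_cast; ring
    rw [e2]
    exact hs
  have hlt := labelEnvelope_add_tol_lt_demand_of_lt e m δ rin rout c 2 s tol he hc hs'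
  have e3 : ∑ w, c w * ((((1 + ((1 : ℕ) : ℤ)) ^ 2 - 1) * (s * m w) : ℤ) : ℝ) = ∑ w, c w * ((((2 : ℤ) ^ 2 - 1) * (s * m w) : ℤ) : ℝ) :=
    sum_congr rfl fun w _ => by push_cast; ring
  have e4 : ∑ w, c w * (((1 + ((1 : ℕ) : ℤ)) * δ w + (1 + ((1 : ℕ) : ℤ) + 1) * (rin w - rout w) +
            ((1 + ((1 : ℕ) : ℤ)) ^ 2 * (s * m w) - (1 + ((1 : ℕ) : ℤ)) * δ w - (1 + ((1 : ℕ) : ℤ) + 1) * rin w) % e w : ℤ) : ℝ) =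
      ∑ w, c w * (((2 : ℤ) * δ w + (2 + 1) * (rin w - rout w) + ((2 : ℤ) ^ 2 * (s * m w) - 2 * δ w - (2 + 1) * rin w) % e w : ℤ) : ℝ) :=
    sum_congr rfl fun w _ => by norm_num
  rw [e3, e4] at h2
  linarith

/-- **CELLWISE ⟹ LABEL-GLOBAL, at every dilation.** If every cell of label `j` is licensed (`HullCellδ e_w (s·m_w) j δ_w r_in r_out` at every bad
place — label `j` of Σ₄ is full), then the label-`j` place-summed licence holds with tolerance `0` (sum of licensed cells; `c_w ≥ 0`): the label-global
reading is WEAKER than the cellwise one, so its height-extinction is implied by, and no later than a weighted average of, the cellwise extinctions.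
[folklore] -/
theorem labelGlobal_of_cellwise (e m δ rin rout : Fin n → ℤ) (c : Fin n → ℝ) (j s : ℤ) (hc : ∀ w, 0 ≤ c w)
    (h : ∀ w, HullCellδ (e w) (s * m w) j (δ w) (rin w) (rout w)) :
    ∑ w, c w * (((j ^ 2 - 1) * (s * m w) : ℤ) : ℝ) ≤
      ∑ w, c w * ((j * δ w + (j + 1) * (rin w - rout w) + (j ^ 2 * (s * m w) - j * δ w - (j + 1) * rin w) % e w : ℤ) : ℝ) := by
  refine sum_le_sum fun w _ => mul_le_mul_of_nonneg_left ?_ (hc w)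
  exact_mod_cast (hullCellδ_dilate_iff (e w) (m w) j (δ w) (rin w) (rout w) s).mp (h w)

/-! ## §4. The worked place FREY `p = 7`, `l = 107` as a one-place datum: label `2`'s bracket and exact crossing -/

/-- Label `2`'s caps and slope at the worked place (`e = 1605`, `m = 210`, `δ = 1604`, `r_in = 268`, `r_out = −4472`): `CAP₂⁻ = 2δ + 3G = 17 428`,
`CAP₂⁺ = CAP₂⁻ + (e − 1) = 19 032`, demand slope `3m = 630`; hence `s₂⁻ = 17 428/630 = 27.66…`, `s₂⁺ = 19 032/630 = 30.20…`. [folklore] -/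
theorem frey7_l107_label2_bracket :
    (2 : ℤ) * 1604 + 3 * (268 - (-4472)) = 17428 ∧ (2 : ℤ) * 1604 + 3 * (268 - (-4472)) + (1605 - 1) = 19032 ∧
    ((2 : ℤ) ^ 2 - 1) * 210 = 630 ∧ (27 : ℤ) * 630 ≤ 17428 ∧ (17428 : ℤ) < 28 * 630 ∧ (30 : ℤ) * 630 ≤ 19032 ∧ (19032 : ℤ) < 31 * 630 := by
  norm_num

/-- **Label `2` of the worked place crosses between `s = 29` and `s = 30`** — inside the bracket `[27.66…, 30.20…]`: the exact cell
`HullCellδ 1605 (s·210) 2 1604 268 (−4472)` HOLDS at `s = 29` and FAILS at `s = 30` (by `decide`); by contrast the all-label netted requirement of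
p532641 §4 at this place fails from `s = 1` on (`frey7_l107_netted_fails_all_dilations`) — per-label and summed thresholds are different closed-form numbers.
[folklore] -/
theorem frey7_l107_label2_crossing :
    HullCellδ 1605 (29 * 210) 2 1604 268 (-4472) ∧ ¬ HullCellδ 1605 (30 * 210) 2 1604 268 (-4472) := by
  unfold HullCellδ
  refine ⟨by decide, by decide⟩

/-! ## §5. The per-label death threshold is NON-INCREASING in the label: the last label to die is `j = 2` (append 2026-08-27, same seat)

The docstring's sentence «`s_j⁺` DECREASES in `j`» as a theorem, in cleared-denominator form. With `A := Σ_w c_w·(δ_w + G_w)` and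
`B := Σ_w c_w·(G_w + (e_w − 1)) + tol` one has `CAP_j⁺ + tol = A·j + B` (`capPlus_add_tol_eq_linear`), `A, B ≥ 0` under the structural
hypotheses of a local field (`e_w − 1 ≤ δ_w`, `r_out ≤ r_in`, `0 < e_w`, `c_w ≥ 0`, `tol ≥ 0`), and for every `j ≥ 0`:
`((j+1)·A + B)·(j² − 1) ≤ (j·A + B)·((j+1)² − 1)` (`linear_mul_sqSubOne_le_succ`), i.e. `s_{j+1}⁺ ≤ s_j⁺` whenever both denominators
`(j²−1)·M`, `((j+1)²−1)·M` are positive (`j ≥ 2`). Hence the label-`2` threshold `S⁺` of `not_labelGlobal_of_lt` dominates every `s_j⁺`, `j ≥ 2`: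
beyond `S⁺` EVERY label `j ≥ 2` is dead, not only label `2` (`labelEnvelope_add_tol_lt_demand_of_lt_of_two`). [folklore] -/

/-- **Abstract monotonicity**: for reals `A, B ≥ 0` and `j ≥ 0`, `((j+1)A + B)(j² − 1) ≤ (jA + B)((j+1)² − 1)` — the difference is
`A·j² + A·j + 2B·j + A + B ≥ 0`. [folklore] -/
theorem linear_mul_sqSubOne_le_succ {A B j : ℝ} (hA : 0 ≤ A) (hB : 0 ≤ B) (hj : 0 ≤ j) :
    ((j + 1) * A + B) * (j ^ 2 - 1) ≤ (j * A + B) * ((j + 1) ^ 2 - 1) := by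
  have h : (j * A + B) * ((j + 1) ^ 2 - 1) - ((j + 1) * A + B) * (j ^ 2 - 1) = A * j ^ 2 + A * j + 2 * B * j + A + B := by ring
  nlinarith [mul_nonneg hA (sq_nonneg j), mul_nonneg hA hj, mul_nonneg hB hj]

/-- **The label-`j` cap plus tolerance is LINEAR in the label**: `Σ_w c_w·(jδ_w + (j+1)G_w + (e_w−1)) + tol = j·Σ_w c_w(δ_w + G_w) +
(Σ_w c_w(G_w + (e_w−1)) + tol)`. [folklore] -/
theorem capPlus_add_tol_eq_linear (e δ rin rout : Fin n → ℤ) (c : Fin n → ℝ) (j : ℤ) (tol : ℝ) :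
    ∑ w, c w * ((j * δ w + (j + 1) * (rin w - rout w) + (e w - 1) : ℤ) : ℝ) + tol =
      (j : ℝ) * ∑ w, c w * ((δ w + (rin w - rout w) : ℤ) : ℝ) + (∑ w, c w * (((rin w - rout w) + (e w - 1) : ℤ) : ℝ) + tol) := by
  rw [mul_sum, ← add_assoc, ← sum_add_distrib]
  congr 1
  refine sum_congr rfl fun w _ => ?_
  push_cast
  ring

/-- The slope `A = Σ_w c_w(δ_w + G_w)` is `≥ 0` (`c_w ≥ 0`, `e_w − 1 ≤ δ_w`, `0 < e_w`, `r_out ≤ r_in`). [folklore] -/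
theorem slope_nonneg (e δ rin rout : Fin n → ℤ) (c : Fin n → ℝ) (he : ∀ w, 0 < e w) (hδ : ∀ w, e w - 1 ≤ δ w)
    (hio : ∀ w, rout w ≤ rin w) (hc : ∀ w, 0 ≤ c w) : 0 ≤ ∑ w, c w * ((δ w + (rin w - rout w) : ℤ) : ℝ) := by
  refine sum_nonneg fun w _ => mul_nonneg (hc w) ?_
  have h1 := he w; have h2 := hδ w; have h3 := hio w
  exact_mod_cast (by omega : (0 : ℤ) ≤ δ w + (rin w - rout w))

/-- The intercept `B = Σ_w c_w(G_w + (e_w − 1)) + tol` is `≥ 0` (`tol ≥ 0`). [folklore] -/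
theorem intercept_nonneg (e rin rout : Fin n → ℤ) (c : Fin n → ℝ) (tol : ℝ) (he : ∀ w, 0 < e w)
    (hio : ∀ w, rout w ≤ rin w) (hc : ∀ w, 0 ≤ c w) (htol : 0 ≤ tol) :
    0 ≤ ∑ w, c w * (((rin w - rout w) + (e w - 1) : ℤ) : ℝ) + tol := by
  refine add_nonneg (sum_nonneg fun w _ => mul_nonneg (hc w) ?_) htol
  have h1 := he w; have h3 := hio w
  exact_mod_cast (by omega : (0 : ℤ) ≤ (rin w - rout w) + (e w - 1))

/-- **`s_{j+1}⁺ ≤ s_j⁺` in cleared-denominator form**: `(CAP_{j+1}⁺ + tol)·(j² − 1) ≤ (CAP_j⁺ + tol)·((j+1)² − 1)` for every `j ≥ 0` under the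
structural hypotheses — the per-label death threshold of `labelEnvelope_add_tol_lt_demand_of_lt` is non-increasing in the label. [folklore] -/
theorem capPlus_succ_mul_le (e δ rin rout : Fin n → ℤ) (c : Fin n → ℝ) (j : ℤ) (tol : ℝ)
    (he : ∀ w, 0 < e w) (hδ : ∀ w, e w - 1 ≤ δ w) (hio : ∀ w, rout w ≤ rin w) (hc : ∀ w, 0 ≤ c w) (htol : 0 ≤ tol) (hj : 0 ≤ j) :
    (∑ w, c w * (((j + 1) * δ w + (j + 1 + 1) * (rin w - rout w) + (e w - 1) : ℤ) : ℝ) + tol) * ((j : ℝ) ^ 2 - 1) ≤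
      (∑ w, c w * ((j * δ w + (j + 1) * (rin w - rout w) + (e w - 1) : ℤ) : ℝ) + tol) * (((j : ℝ) + 1) ^ 2 - 1) := by
  have e1 := capPlus_add_tol_eq_linear e δ rin rout c (j + 1) tol
  have e0 := capPlus_add_tol_eq_linear e δ rin rout c j tol
  rw [e1, e0]
  set A : ℝ := ∑ w, c w * ((δ w + (rin w - rout w) : ℤ) : ℝ) with hAdef
  set B : ℝ := ∑ w, c w * (((rin w - rout w) + (e w - 1) : ℤ) : ℝ) + tol with hBdef
  have hA : 0 ≤ A := slope_nonneg e δ rin rout c he hδ hio hc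
  have hB : 0 ≤ B := intercept_nonneg e rin rout c tol he hio hc htol
  have hj' : (0 : ℝ) ≤ (j : ℝ) := by exact_mod_cast hj
  have hcast : ((j + 1 : ℤ) : ℝ) = (j : ℝ) + 1 := by push_cast; ring
  rw [hcast]
  exact linear_mul_sqSubOne_le_succ hA hB hj'

/-- **Beyond the label-`2` threshold EVERY label `j ≥ 2` is dead** (not only label `2`): if
`Σ_w c_w·(2δ_w + 3G_w + (e_w − 1)) + tol < 3·s·M` then for every integer `j ≥ 2` the label-`j` place-summed licence with tolerance `tol` FAILS at `s`
— because `CAP_j⁺ + tol ≤ ((j²−1)/3)·(CAP₂⁺ + tol)` (the caps grow linearly, `(j²−1)/3 ≥ (j−1)·…`; directly: `A·j + B ≤ ((j²−1)/3)·(2A + B)` for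
`j ≥ 2`, `A, B ≥ 0`) while the demand grows by exactly `(j²−1)/3`. [folklore] -/
theorem labelEnvelope_add_tol_lt_demand_of_lt_of_two (e m δ rin rout : Fin n → ℤ) (c : Fin n → ℝ) (j s : ℤ) (tol : ℝ)
    (he : ∀ w, 0 < e w) (hδ : ∀ w, e w - 1 ≤ δ w) (hio : ∀ w, rout w ≤ rin w) (hc : ∀ w, 0 ≤ c w) (htol : 0 ≤ tol) (hj : 2 ≤ j)
    (hs : ∑ w, c w * ((2 * δ w + 3 * (rin w - rout w) + (e w - 1) : ℤ) : ℝ) + tol <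
        3 * (s : ℝ) * ∑ w, c w * ((m w : ℤ) : ℝ)) :
    ∑ w, c w * ((j * δ w + (j + 1) * (rin w - rout w) + (j ^ 2 * (s * m w) - j * δ w - (j + 1) * rin w) % e w : ℤ) : ℝ) + tol <
      ∑ w, c w * (((j ^ 2 - 1) * (s * m w) : ℤ) : ℝ) := by
  refine labelEnvelope_add_tol_lt_demand_of_lt e m δ rin rout c j s tol he hc ?_
  -- linear form of both caps
  have eJ := capPlus_add_tol_eq_linear e δ rin rout c j tol
  have e2 := capPlus_add_tol_eq_linear e δ rin rout c 2 tol
  have h2 : ∑ w, c w * (((2 : ℤ) * δ w + (2 + 1) * (rin w - rout w) + (e w - 1) : ℤ) : ℝ) =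
      ∑ w, c w * ((2 * δ w + 3 * (rin w - rout w) + (e w - 1) : ℤ) : ℝ) :=
    sum_congr rfl fun w _ => by push_cast; ring
  rw [h2] at e2
  set A : ℝ := ∑ w, c w * ((δ w + (rin w - rout w) : ℤ) : ℝ) with hAdef
  set B : ℝ := ∑ w, c w * (((rin w - rout w) + (e w - 1) : ℤ) : ℝ) + tol with hBdef
  set M : ℝ := ∑ w, c w * ((m w : ℤ) : ℝ) with hMdef
  have hA : 0 ≤ A := slope_nonneg e δ rin rout c he hδ hio hc
  have hB : 0 ≤ B := intercept_nonneg e rin rout c tol he hio hc htol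
  have hj' : (2 : ℝ) ≤ (j : ℝ) := by exact_mod_cast hj
  -- from hs: 2A + B < 3 s M
  have hs' : ((2 : ℤ) : ℝ) * A + B < 3 * (s : ℝ) * M := by rw [← e2]; exact hs
  push_cast at hs'
  -- goal: A j + B < s (j² − 1) M
  rw [eJ]
  -- (j²−1)/3 ≥ 1 and A j + B ≤ ((j²−1)/3)(2A + B)
  have hcap : (j : ℝ) * A + B ≤ (((j : ℝ) ^ 2 - 1) / 3) * (2 * A + B) := by
    nlinarith [mul_nonneg hA (sub_nonneg.mpr hj'), mul_nonneg hB (sub_nonneg.mpr hj'), mul_nonneg hA (mul_nonneg (sub_nonneg.mpr hj') (sub_nonneg.mpr hj')),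
      mul_nonneg hB (mul_nonneg (sub_nonneg.mpr hj') (sub_nonneg.mpr hj'))]
  have hpos : 0 < ((j : ℝ) ^ 2 - 1) / 3 := by nlinarith
  calc (j : ℝ) * A + B ≤ (((j : ℝ) ^ 2 - 1) / 3) * (2 * A + B) := hcap
    _ < (((j : ℝ) ^ 2 - 1) / 3) * (3 * (s : ℝ) * M) := mul_lt_mul_of_pos_left hs' hpos
    _ = (s : ℝ) * ((j : ℝ) ^ 2 - 1) * M := by ring

/-! ## §6. LABEL-SET CUTS (R4 census row O-22, KEY R4K2CUT): for EVERY finite set `J` of labels the netted cut-requirement has a closed-form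
height bracket — it HOLDS for `s ≤ s_J⁻ = CAP_J⁻/D_J` and FAILS for `s > s_J⁺ = (CAP_J⁺ + tol)/D_J` (append 2026-08-27, same seat)

Summing §2 over a label set `J : Finset ℤ` (e.g. print's full set `{1, …, l⋆}`, the «half» cut `{1, …, ⌈l⋆/2⌉}`, the «sqrt» cut `{1, …, ⌈√l⋆⌉}`, the parity
subsets of REQB-SPEC k2, or ANY other subset): with `D_J := (Σ_{j∈J}(j²−1))·Σ_w c_w m_w` (demand slope) and `CAP_J^± := Σ_{j∈J} CAP_j^±` the label-set envelope
`ENV_J(s) = Σ_{j∈J} Σ_w c_w·price_j(w,s)` is HEIGHT-FREE between `CAP_J⁻` and `CAP_J⁺` while `DEM_J(s) = s·D_J`: the cut changes the CONSTANTS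
(`s_J^±`), never the exponent — kept fraction `≤ CAP_J⁺/(s·D_J) ∝ s⁻¹`, deficit `DEM_J − ENV_J ≥ s·D_J − CAP_J⁺ ∝ s`. So along the R78 ray every label-set
cut containing a label `≥ 2` is a TABULATED-HEIGHT statement, exactly like the full set (p532641) and like each single label (§2). [folklore] -/

/-- **LABEL-SET ENVELOPE ≤ CAP_J⁺** (height-free; any finite label set `J`). [folklore] -/
theorem labelSet_envelope_le_capPlus (J : Finset ℤ) (e m δ rin rout : Fin n → ℤ) (c : Fin n → ℝ) (s : ℤ)
    (he : ∀ w, 0 < e w) (hc : ∀ w, 0 ≤ c w) :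
    ∑ j ∈ J, ∑ w, c w * ((j * δ w + (j + 1) * (rin w - rout w) + (j ^ 2 * (s * m w) - j * δ w - (j + 1) * rin w) % e w : ℤ) : ℝ) ≤
      ∑ j ∈ J, ∑ w, c w * ((j * δ w + (j + 1) * (rin w - rout w) + (e w - 1) : ℤ) : ℝ) :=
  sum_le_sum fun j _ => labelEnvelope_le_capPlus e m δ rin rout c j s he hc

/-- **CAP_J⁻ ≤ LABEL-SET ENVELOPE** (height-free; any finite label set `J`). [folklore] -/
theorem labelSet_capMinus_le_envelope (J : Finset ℤ) (e m δ rin rout : Fin n → ℤ) (c : Fin n → ℝ) (s : ℤ)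
    (he : ∀ w, 0 < e w) (hc : ∀ w, 0 ≤ c w) :
    ∑ j ∈ J, ∑ w, c w * ((j * δ w + (j + 1) * (rin w - rout w) : ℤ) : ℝ) ≤
      ∑ j ∈ J, ∑ w, c w * ((j * δ w + (j + 1) * (rin w - rout w) + (j ^ 2 * (s * m w) - j * δ w - (j + 1) * rin w) % e w : ℤ) : ℝ) :=
  sum_le_sum fun j _ => labelCapMinus_le_envelope e m δ rin rout c j s he hc

/-- **The label-set demand is the dilation times a height-free number**: `Σ_{j∈J} Σ_w c_w(j²−1)(s·m_w) = s·Σ_{j∈J}((j²−1)·M)`. [folklore] -/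
theorem labelSet_demand_dilate (J : Finset ℤ) (m : Fin n → ℤ) (c : Fin n → ℝ) (s : ℤ) :
    ∑ j ∈ J, ∑ w, c w * (((j ^ 2 - 1) * (s * m w) : ℤ) : ℝ) =
      (s : ℝ) * ∑ j ∈ J, (((j : ℝ) ^ 2 - 1) * ∑ w, c w * ((m w : ℤ) : ℝ)) := by
  rw [mul_sum]
  refine sum_congr rfl fun j _ => ?_
  rw [labelDemand_dilate]
  ring

/-- **A LABEL-SET CUT DIES BEYOND `s_J⁺`, explicit threshold** (any finite `J`): if `CAP_J⁺ + tol < s·D_J`, i.e.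
`Σ_{j∈J} Σ_w c_w(jδ_w + (j+1)G_w + (e_w−1)) + tol < s·Σ_{j∈J}((j²−1)·Σ_w c_w m_w)`, then `ENV_J(s) + tol < DEM_J(s)`: the netted requirement restricted to the
label set `J` FAILS at the dilation `s` — for print's full set, for the half / sqrt / parity cuts, for any subset. [folklore] -/
theorem labelSet_envelope_add_tol_lt_demand_of_lt (J : Finset ℤ) (e m δ rin rout : Fin n → ℤ) (c : Fin n → ℝ) (s : ℤ) (tol : ℝ)
    (he : ∀ w, 0 < e w) (hc : ∀ w, 0 ≤ c w)
    (hs : ∑ j ∈ J, ∑ w, c w * ((j * δ w + (j + 1) * (rin w - rout w) + (e w - 1) : ℤ) : ℝ) + tol <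
        (s : ℝ) * ∑ j ∈ J, (((j : ℝ) ^ 2 - 1) * ∑ w, c w * ((m w : ℤ) : ℝ))) :
    ∑ j ∈ J, ∑ w, c w * ((j * δ w + (j + 1) * (rin w - rout w) + (j ^ 2 * (s * m w) - j * δ w - (j + 1) * rin w) % e w : ℤ) : ℝ) + tol <
      ∑ j ∈ J, ∑ w, c w * (((j ^ 2 - 1) * (s * m w) : ℤ) : ℝ) := by
  have h1 := labelSet_envelope_le_capPlus J e m δ rin rout c s he hc
  have h2 := labelSet_demand_dilate J m c s
  linarith

/-- **A LABEL-SET CUT HOLDS BELOW `s_J⁻`, explicit threshold** (any finite `J`): if `s·D_J ≤ CAP_J⁻` then `DEM_J(s) ≤ ENV_J(s)` (tolerance-free, whatever the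
residues) — the tabulated side. [folklore] -/
theorem labelSet_demand_le_envelope_of_le (J : Finset ℤ) (e m δ rin rout : Fin n → ℤ) (c : Fin n → ℝ) (s : ℤ)
    (he : ∀ w, 0 < e w) (hc : ∀ w, 0 ≤ c w)
    (hs : (s : ℝ) * ∑ j ∈ J, (((j : ℝ) ^ 2 - 1) * ∑ w, c w * ((m w : ℤ) : ℝ)) ≤
        ∑ j ∈ J, ∑ w, c w * ((j * δ w + (j + 1) * (rin w - rout w) : ℤ) : ℝ)) :
    ∑ j ∈ J, ∑ w, c w * (((j ^ 2 - 1) * (s * m w) : ℤ) : ℝ) ≤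
      ∑ j ∈ J, ∑ w, c w * ((j * δ w + (j + 1) * (rin w - rout w) + (j ^ 2 * (s * m w) - j * δ w - (j + 1) * rin w) % e w : ℤ) : ℝ) := by
  have h1 := labelSet_capMinus_le_envelope J e m δ rin rout c s he hc
  have h2 := labelSet_demand_dilate J m c s
  linarith

/-- **THE LABEL-SET CROSSING BRACKET** (both sides; `tol ≥ 0`): for ANY finite label set `J` the netted cut-requirement «`DEM_J(s) ≤ ENV_J(s) + tol`» HOLDS at
every dilation `s ≤ s_J⁻` and FAILS at every `s > s_J⁺`, the two thresholds differing by `(Σ_{j∈J} Σ_w c_w(e_w−1) + tol)/D_J` — a closed-form bracket on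
the crossing of every k2 label-set cut along the height ray (census row O-22). [folklore] -/
theorem labelSet_crossing_bracket (J : Finset ℤ) (e m δ rin rout : Fin n → ℤ) (c : Fin n → ℝ) (s : ℤ) (tol : ℝ)
    (he : ∀ w, 0 < e w) (hc : ∀ w, 0 ≤ c w) (htol : 0 ≤ tol) :
    ((s : ℝ) * ∑ j ∈ J, (((j : ℝ) ^ 2 - 1) * ∑ w, c w * ((m w : ℤ) : ℝ)) ≤ ∑ j ∈ J, ∑ w, c w * ((j * δ w + (j + 1) * (rin w - rout w) : ℤ) : ℝ) →
      ∑ j ∈ J, ∑ w, c w * (((j ^ 2 - 1) * (s * m w) : ℤ) : ℝ) ≤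
        ∑ j ∈ J, ∑ w, c w * ((j * δ w + (j + 1) * (rin w - rout w) + (j ^ 2 * (s * m w) - j * δ w - (j + 1) * rin w) % e w : ℤ) : ℝ) + tol) ∧
    (∑ j ∈ J, ∑ w, c w * ((j * δ w + (j + 1) * (rin w - rout w) + (e w - 1) : ℤ) : ℝ) + tol <
        (s : ℝ) * ∑ j ∈ J, (((j : ℝ) ^ 2 - 1) * ∑ w, c w * ((m w : ℤ) : ℝ)) →
      ¬ (∑ j ∈ J, ∑ w, c w * (((j ^ 2 - 1) * (s * m w) : ℤ) : ℝ) ≤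
        ∑ j ∈ J, ∑ w, c w * ((j * δ w + (j + 1) * (rin w - rout w) + (j ^ 2 * (s * m w) - j * δ w - (j + 1) * rin w) % e w : ℤ) : ℝ) + tol)) := by
  refine ⟨fun hs => ?_, fun hs h => ?_⟩
  · have := labelSet_demand_le_envelope_of_le J e m δ rin rout c s he hc hs
    linarith
  · have := labelSet_envelope_add_tol_lt_demand_of_lt J e m δ rin rout c s tol he hc hs
    linarith

end Summit.ABC.IUTFork.Repair.RcatLabelGlobalHeightScaling
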